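import Mathlib
import Summits.ResolutionOfSingularities.ResolutionOfSingularities.Theorems.WeightedInvariantLocalWeightedDropWildMonicSCleanStepExists
import Summits.ResolutionOfSingularities.ResolutionOfSingularities.Theorems.WeightedInvariantLocalWeightedDropWildMonicWCleanProcess

/-!
# `WeightedInvariant.LocalWeightedDrop`, line `hasse-ridge-face-selection`, S3ρ sub-stub S3ρD `stub_wildMonicSurfaceDescent`:
# THE SECONDARY CLEANING PROCESS at an `s`-maximal position terminates — Perlega Proposition 5.2.9, finite branch, for monic tuples

Crux item stmt-ResolutionOfSingularities-8899 `LocalWeightedDrop` (route `ResolutionOfSingularities/WeightedInvariant`), engine of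
the door `HypersurfaceCentreConstruction` stmt-ResolutionOfSingularities-19897.  [OURS · L1 W4.3, chain w43, res-L1-w43-stub-7 (second
seat on S3ρ under res-type-083); item (C4d) of `L/res-L1-w43-stub-7/S3RHOD-ROADMAP.md`.  MODEL: S. Perlega, thesis Wien 2017 /
arXiv:2011.14443, Ch. 5 §2.2, the secondary `ord`-cleaning process and PROPOSITION 5.2.9 (s_cleaning_terminates): «either the process
terminates in finitely many steps, or … `J_{-2}^{(∞)} = 0`».  Nothing here is a statement of H. Hironaka's manuscript
[claim: Hironaka2017, status: under-review]; OUR objects.]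

WHAT IS PROVED.  In the (C9) assembly of res-type-083 the `s`-entry of a flag is MAXIMISED over re-centrings first (res-L1-w43-stub-3's
attainment theorem, D-0); at such an `s`-MAXIMAL position the second branch of Prop. 5.2.9 cannot occur: every step keeps `s`
(`s ≤ s̃ ≤ s`), so by Lemma 5.2.8 (`sClean_step`, p515329) the least unclean index strictly increases while staying below
`(δ + r₁)/d!`; hence after finitely many monomial steps the position is SECONDARY CLEAN, with the same `(δ, r, s)`, every `w`-cleanness
of the start preserved, and no `m_w` decreased:
* `one_le_sFlag` — `1 ≤ sFlag` always (a reduced point below the row `δ` has `Q₀ ≥ 1`);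
* `exists_shift_isSClean_of_sMax` — THE FINITE SECONDARY CLEANING PROCESS at an `s`-maximal, `(1,1)`/`(1,0)`/`(0,1)`-clean position.
-/

set_option linter.dupNamespace false -- mandated namespace of this single-conjunct summit

noncomputable section

namespace Summit.ResolutionOfSingularities.ResolutionOfSingularities.Theorems

namespace WildMonic

open MvPowerSeries MonicDescent

variable {k : Type} [Field k] {d : ℕ}

/-- `1 ≤ sFlag` ALWAYS: a reduced point `Q` below the row `δ` has `Q₀ + Q₁ ≥ δ > Q₁`, so `Q₀ ≥ 1` and its term is `≥ 1`. -/
theorem one_le_sFlag (E : Finset (Fin 2)) (A : Fin d → MvPowerSeries (Fin 2) k) : (1 : ℕ∞) ≤ sFlag E (newtonSet A) := by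
  rw [← Nat.cast_one]
  unfold sFlag
  rw [natCast_le_coeffOrd_iff]
  intro P hP h1
  have hδ : dRes E (newtonSet A) ≤ P 0 + P 1 := deltaL_le hP
  have h2 : 1 ≤ P 0 := by omega
  calc 1 * (dRes E (newtonSet A) - P 1) ≤ dRes E (newtonSet A) := by omega
    _ ≤ (dRes E (newtonSet A)).factorial := Nat.self_le_factorial _
    _ ≤ (dRes E (newtonSet A)).factorial * P 0 := Nat.le_mul_of_pos_right _ h2

section Process

variable (p : ℕ) [Fact p.Prime] [CharP k p] [PerfectRing k p] (E : Finset (Fin 2))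

omit [Fact p.Prime] [CharP k p] [PerfectRing k p] in
/-- The exponent of a secondary cleaning step is not zero (its monomial is on the `s`-line below the row `δ`, and `s ≥ 1`). -/
theorem ne_zero_of_onSLine_smul (A : Fin d → MvPowerSeries (Fin 2) k) {s : ℕ} (hs : sFlag E (newtonSet A) = s) (iq : Fin d)
    {m : Fin 2 →₀ ℕ} (hstar : coeff (qOf p d • m) (A iq) ≠ 0)
    (hon : OnSLine (dRes E (newtonSet A)) (s : ℕ∞) (redPt A E iq (qOf p d • m))) : m ≠ 0 := by
  intro h0
  have h1 := one_le_sFlag E A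
  rw [hs, Nat.one_le_cast] at h1
  have hδ : 0 < dRes E (newtonSet A) := lt_of_le_of_lt (Nat.zero_le _) hon.1
  have h := (onSLine_iff_val E A rfl s iq hstar).1 hon
  rw [h0, smul_zero, map_zero, mul_zero, Finsupp.coe_zero, Pi.zero_apply, mul_zero] at h
  obtain ⟨-, hval⟩ := h
  have : 1 * 1 ≤ s * dRes E (newtonSet A) := Nat.mul_le_mul h1 hδ
  omega

/-- THE FINITE SECONDARY CLEANING PROCESS (Perlega Prop. 5.2.9, first branch) AT AN `s`-MAXIMAL POSITION.  If the position `A` (finite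
`s = sFlag`) is `(1,1)`-clean, `(1,0)`-clean if `0 ∈ E`, `(0,1)`-clean if `1 ∈ E`, and NO re-centring `g` (`g(0) = 0`) preserving the
setting `(δ, r)` raises `s`, then some re-centring `g` (`g(0) = 0`; a finite sum of the monomial steps) makes it SECONDARY CLEAN with the same
`(δ, r, s)`, every `w`-cleanness of `A` preserved with the same `m_w`, and no `m_w` decreased. -/
theorem exists_shift_isSClean_of_sMax (n : ℕ) :
    ∀ (A : Fin d → MvPowerSeries (Fin 2) k) {s : ℕ}, sFlag E (newtonSet A) = s →
      (∀ iq : Fin d, (iq : ℕ) = d - qOf p d →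
      IsWClean p ![1, 1] A → ((0 : Fin 2) ∈ E → IsWClean p ![1, 0] A) → ((1 : Fin 2) ∈ E → IsWClean p ![0, 1] A) →
      (∀ g : MvPowerSeries (Fin 2) k, constantCoeff g = 0 →
        excExp E (newtonSet (shift d A g)) = excExp E (newtonSet A) → dRes E (newtonSet (shift d A g)) = dRes E (newtonSet A) →
        sFlag E (newtonSet (shift d A g)) ≤ s) →
      (∀ b : ℕ, d.factorial * b < dRes E (newtonSet A) + excExp E (newtonSet A) 1 → ¬ SCleanAt p E A b →
        dRes E (newtonSet A) + excExp E (newtonSet A) 1 - b ≤ n) →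
      ∃ g : MvPowerSeries (Fin 2) k, constantCoeff g = 0 ∧
        (∀ w : Fin 2 → ℕ, IsWClean p w A → IsWClean p w (shift d A g) ∧ wMin w (shift d A g) = wMin w A) ∧
        (∀ w : Fin 2 → ℕ, wMin w A ≤ wMin w (shift d A g)) ∧
        excExp E (newtonSet (shift d A g)) = excExp E (newtonSet A) ∧
        dRes E (newtonSet (shift d A g)) = dRes E (newtonSet A) ∧
        sFlag E (newtonSet (shift d A g)) = s ∧ IsSClean p E (shift d A g)) := by
  induction n with
  | zero =>
    intro A s hs iq hiq h11 h10 h01 hmax hB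
    refine ⟨0, map_zero _, ?_⟩
    rw [shift_zero]
    refine ⟨fun w hw => ⟨hw, rfl⟩, fun w => le_rfl, rfl, rfl, hs, ?_⟩
    rw [isSClean_iff_forall_sCleanAt]
    intro b hb
    by_contra hc
    have h1 := hB b hb hc
    have h2 : b ≤ d.factorial * b := Nat.le_mul_of_pos_left _ (Nat.factorial_pos d)
    omega
  | succ n ih =>
    intro A s hs iq hiq h11 h10 h01 hmax hB
    by_cases hclean : IsSClean p E A
    · exact ⟨0, map_zero _, by rw [shift_zero]; exact ⟨fun w hw => ⟨hw, rfl⟩, fun w => le_rfl, rfl, rfl, hs, hclean⟩⟩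
    -- ONE STEP (Lemma 5.2.8 packaged)
    obtain ⟨m, lam, b, hlam0, hb, hnot, hbefore, hGm, hpres, hr, hδ, hsle, h528⟩ :=
      sClean_step p E A hs hclean iq hiq h11 h10 h01
    -- the step monomial is not constant
    have hm0 : m ≠ 0 := by
      intro h0
      obtain ⟨i, e, he, hon⟩ := exists_onSLine_of_sFlag_eq E A hs
      have hlt : redPt A E i e 1 < dRes E (newtonSet A) := hon.1
      have h1 : (1 : ℕ∞) ≤ wMin ![1, 1] A := by
        refine (le_wMin_iff_redPt E A _).2 fun i' e' he' => ?_
        have hle : dRes E (newtonSet A) ≤ redPt A E i' e' 0 + redPt A E i' e' 1 := deltaL_le (redPt_mem_reduce A E i' he')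
        rw [← Nat.cast_one, Nat.cast_le, Literature.AlgebraicGeometry.Resolution.WeightedShear.weight_fin_two]
        omega
      have h2 := hGm ![1, 1]
      rw [h0, weightedOrder_monomial_of_ne_zero _ hlam0, map_zero, Nat.cast_zero, mul_zero] at h2
      exact absurd (h1.trans h2) (by simp)
    have hg0 : constantCoeff (monomial m lam : MvPowerSeries (Fin 2) k) = 0 := by
      classical
      rw [← coeff_zero_eq_constantCoeff_apply, coeff_monomial, if_neg (Ne.symm hm0)]
    -- `s` is kept (maximality), so Lemma 5.2.8 applies
    have hsB : sFlag E (newtonSet (shift d A (monomial m lam))) = s := le_antisymm (hmax _ hg0 hr hδ) hsle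
    have hcleanB := h528 hsB
    -- the hypotheses pass to the new position
    have hmaxB : ∀ g : MvPowerSeries (Fin 2) k, constantCoeff g = 0 →
        excExp E (newtonSet (shift d (shift d A (monomial m lam)) g)) = excExp E (newtonSet (shift d A (monomial m lam))) →
        dRes E (newtonSet (shift d (shift d A (monomial m lam)) g)) = dRes E (newtonSet (shift d A (monomial m lam))) →
        sFlag E (newtonSet (shift d (shift d A (monomial m lam)) g)) ≤ s := by
      intro g hg hrg hδg
      rw [shift_shift] at hrg hδg ⊢
      exact hmax (g + monomial m lam) (by rw [map_add, hg, hg0, add_zero]) (hrg.trans hr) (hδg.trans hδ)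
    have hBB : ∀ b' : ℕ, d.factorial * b' < dRes E (newtonSet (shift d A (monomial m lam))) +
        excExp E (newtonSet (shift d A (monomial m lam))) 1 → ¬ SCleanAt p E (shift d A (monomial m lam)) b' →
        dRes E (newtonSet (shift d A (monomial m lam))) + excExp E (newtonSet (shift d A (monomial m lam))) 1 - b' ≤ n := by
      intro b' hb' hnc
      rw [hδ, hr] at hb' ⊢
      have hgt : b < b' := by
        by_contra hle
        exact hnc (hcleanB b' (not_lt.1 hle))
      have h1 := hB b hb hnot
      omega
    obtain ⟨g₂, hg₂0, hpres₂, hmono₂, hr₂, hδ₂, hs₂, hclean₂⟩ :=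
      ih (shift d A (monomial m lam)) hsB iq hiq (hpres _ h11).1 (fun h => (hpres _ (h10 h)).1) (fun h => (hpres _ (h01 h)).1)
        hmaxB hBB
    refine ⟨g₂ + monomial m lam, by rw [map_add, hg₂0, hg0, add_zero], ?_, ?_, ?_, ?_, ?_, ?_⟩
    · intro w hw
      rw [← shift_shift]
      obtain ⟨hwB, hmB⟩ := hpres w hw
      obtain ⟨hw₂, hm₂⟩ := hpres₂ w hwB
      exact ⟨hw₂, hm₂.trans hmB⟩
    · intro w
      rw [← shift_shift]
      exact (wMin_le_wMin_shift w A _ (hGm w)).trans (hmono₂ w)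
    · rw [← shift_shift]; exact hr₂.trans hr
    · rw [← shift_shift]; exact hδ₂.trans hδ
    · rw [← shift_shift]; exact hs₂
    · rw [← shift_shift]; exact hclean₂

/-- THE FINITE SECONDARY CLEANING PROCESS, packaged: at an `s`-maximal position with finite `s`, `0 < d`, clean for `(1,1)` and for the
exceptional letters' weights, some re-centring `g` with `g(0) = 0` makes it secondary clean with the same `(δ, r, s)`, the same `m_w`
for every `w` the start was clean for, and no `m_w` decreased. -/
theorem exists_shift_isSClean (hd : 0 < d) (A : Fin d → MvPowerSeries (Fin 2) k) {s : ℕ} (hs : sFlag E (newtonSet A) = s)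
    (h11 : IsWClean p ![1, 1] A) (h10 : (0 : Fin 2) ∈ E → IsWClean p ![1, 0] A) (h01 : (1 : Fin 2) ∈ E → IsWClean p ![0, 1] A)
    (hmax : ∀ g : MvPowerSeries (Fin 2) k, constantCoeff g = 0 →
      excExp E (newtonSet (shift d A g)) = excExp E (newtonSet A) → dRes E (newtonSet (shift d A g)) = dRes E (newtonSet A) →
      sFlag E (newtonSet (shift d A g)) ≤ s) :
    ∃ g : MvPowerSeries (Fin 2) k, constantCoeff g = 0 ∧
      (∀ w : Fin 2 → ℕ, IsWClean p w A → IsWClean p w (shift d A g) ∧ wMin w (shift d A g) = wMin w A) ∧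
      (∀ w : Fin 2 → ℕ, wMin w A ≤ wMin w (shift d A g)) ∧
      excExp E (newtonSet (shift d A g)) = excExp E (newtonSet A) ∧
      dRes E (newtonSet (shift d A g)) = dRes E (newtonSet A) ∧
      sFlag E (newtonSet (shift d A g)) = s ∧ IsSClean p E (shift d A g) := by
  have hq := qOf_pos p d
  exact exists_shift_isSClean_of_sMax p E (dRes E (newtonSet A) + excExp E (newtonSet A) 1) A hs ⟨d - qOf p d, by omega⟩ rfl
    h11 h10 h01 hmax (fun b _ _ => Nat.sub_le _ _)

end Process

end WildMonic

end Summit.ResolutionOfSingularities.ResolutionOfSingularities.Theorems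

end
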